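import Summits.ABC.IUTFork.Cor312PilotIdelesPrSlotHull
import Summits.ABC.IUTFork.Cor312ThetaSlotContentExactK
import Summits.ABC.IUTFork.Cor312ThetaSideExactKOfGe
import HarnessLib

/-!
# [IUTchIII] Cor. 3.12 IN READING (P) at the `K`-level sharp setting — NONARCHIMEDEAN EXACTNESS, UNCONDITIONAL:
# `−|log(Θ)|^{(P)}(settingPrVolSharp (pilotDataOfK D K) …) = ↑I.negLogThetaPerImageNonarch ≤ ↑I.negLogThetaPerImage` for every realising choice of Θ-ideles

PROOF-ONLY file (D-0012; no definitions, no `Prop` facts) of the abc-iut cell (R2 S-chain team, seat abc-iut-s2-p7 gen 3, CLAIM «HΘP-K»). TAKES NO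
SIDE on [IUTchIII] Cor. 3.12 or on the reading (U)/(P) of `−|log(Θ)|`. DISCHARGES the READ-P binder `hReadP` of abc-iut-C-cert-2's γ certificate
`Conditional.abc_of_slotLicence_orNumP_K_szpiroBad` (`AbcOfSlotLicenceGenuineK`, p458998): «∀ T, (settingPrVolSharp (pilotDataOfK T.D T.K) … chosen
ideles …).negLogThetaSlot ≤ ↑T.negLogThetaPerImage» — here as an EQUALITY with abc-iut-S7's nonarchimedean PER-IMAGE number plus the archimedean
slack. The reading-(P) twin of this seat's `Cor312ThetaSideExactK` (p453133, reading (U): `negLogTheta = ↑I.negLogThetaNonarch`), on abc-iut-C-cert-2's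
`Cor312SlotHull` (p458847: `negLogThetaSlot` = the procession-normalised sum of the log-volumes of the hulls of the (Ind2)-SLOT images).

* §1 `procAvg_sum_weightPr_lastSlot_content_below_eq_negLogThetaPerImageLoc` — per prime, the `Pr_K`-weighted LAST-slot content-hull sum over the
  tuples of `K`, averaged over the procession, IS `I.negLogThetaPerImageLoc p` (abc-iut-w5-d056's Galois descent `sum_weightPr_mul_contentHull_eq_placeSection`
  VERBATIM — same summand shape as abc-iut-s2-p6's (U)-descent `procAvg_sum_weightPr_content_below_eq_negLogThetaLoc`, p447368 — then
  `negLogThetaPerImageLoc_eq_of_perImageContent`, abc-iut-s2-p2's exact per-image formula); `thetaSlotLocal_settingPrVolSharp_pilotDataOfK_eq_sum_lastSlot_content_below`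
  — per packet at EVERY prime, the slot term of the `K`-level sharp setting `=` the exact last-slot content sum (`Cor312PilotIdelesPrSlotHull` at the
  genuine per-image contents read below the tuples, `Cor312ThetaSlotContentExactK`);
* §2 **`negLogThetaSlot_settingPrVolSharp_pilotDataOfK_eq_negLogThetaPerImageNonarch`** — for idele data `r` of `D`, EVERY realising Θ-idele `t` and ANY
  `q`-ideles: `(settingPrVolSharp (pilotDataOfK D K) … tq t _ _).negLogThetaSlot = ↑(volumeInputOf D r).negLogThetaPerImageNonarch` (off `T(I)` and at `∞` the
  slot term is `0`: [IUTchIV] Thm. 1.10 Steps (vi), (vii); `Cor312SlotHullLocal.negLogThetaSlot_eq_of_thetaSlotLocal_eq` sums); `…_of_isVolumeInputOf`;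
  **`negLogThetaSlot_settingPrVolSharp_pilotDataOfK_le_negLogThetaPerImage_of_isVolumeInputOf`** (`+ ((l+5)/4)·log π > 0`, abc-iut-S2 `archLogTheta_pos`);
The sequel `Cor312ThetaSlotExactKDatum` reads these at a genuine Θ-volume DATUM `T` (every realising Θ-idele, and the CHOSEN ones — LITERALLY `hReadP`).

[cite: Mochizuki2012, IUTchIII Cor. 3.12 p. 173–174, proof Step (x) p. 181; Thm. 3.11 (i) (Ind2) p. 154] [cite: Mochizuki2012, IUTchIV Thm. 1.10 Steps
(v)–(viii) p. 27–31] [cite: Mochizuki2012, IUTchI Rmk. 3.1.5 p. 65] [cite: DupuyHilado2025, Def. 3.6.3, §3.9, §4.9, §4.11–4.12] [claim: Mochizuki2012,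
status: disputed] for every quoted construction. HONEST FRAMING: an identity between OUR two typings of the per-image nonarchimedean quantity (sharp (Ind3)
reading, DH-level factorwise (Ind2), trivial archimedean container); reading (P) is STRONGER than print's hull of the union; nothing here asserts or
denies Cor. 3.12 for any initial Θ-data or takes a side on any author; typed ≠ proved; instantiated ≠ endorsed.
-/

noncomputable section

open Set Function NumberField IsDedekindDomain
open scoped Pointwise

namespace Summit.ABC.IUTFork.Thm311.Real

open Cor312 Cor312Vol Cor312Prov Literature.IUT.LogThetaLattice Literature.IUT.LogVolume Literature.IUT.HodgeTheaters
  Literature.NumberTheory.NumberFields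

variable {F K Fbar : Type} [Field F] [NumberField F] [Field K] [NumberField K] [Algebra F K] [Field Fbar]
  [Algebra F Fbar] [Algebra K Fbar] {E : WeierstrassCurve F} [E.IsElliptic] {l : ℕ} {Pb : BadPlacePredicates K}
  (D : InitialThetaData F K Fbar E l Pb) (r : ThetaData.IdeleData D)

/-! ## §1. Per prime: the descended LAST-slot content sum IS the genuine per-image local term; per packet `=` -/

section Content

variable
  (mP : (p : ℕ) → (i : Fin (ThetaData.volumeInputOf D r).lstar) → (Fin ((i : ℕ) + 1 + 1) → placesOver (fieldOfModuli E) p) → ℤ)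
  (hmP : ∀ (p : ℕ) [hp : Fact p.Prime] (i : Fin (ThetaData.volumeInputOf D r).lstar) (e : Fin ((i : ℕ) + 1 + 1) → placesOver (fieldOfModuli E) p),
    iota p (fun b => ((ThetaData.volumeInputOf D r).σ.localFieldFamily p hp.out).k (e b)) (Fin.last _)
          ((ThetaData.volumeInputOf D r).tΘ p hp.out i (e (Fin.last _)) :
            ((ThetaData.volumeInputOf D r).σ.localFieldFamily p hp.out).k (e (Fin.last _))) •
        (normalizedPacket p (fun b => ((ThetaData.volumeInputOf D r).σ.localFieldFamily p hp.out).k (e b)) :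
          Set (PacketAlgebra p (fun b => ((ThetaData.volumeInputOf D r).σ.localFieldFamily p hp.out).k (e b)))) ⊆
      ((p : ℚ_[p]) ^ mP p i e) • (logPacket p (fun b => ((ThetaData.volumeInputOf D r).σ.localFieldFamily p hp.out).k (e b)) :
          Set (PacketAlgebra p (fun b => ((ThetaData.volumeInputOf D r).σ.localFieldFamily p hp.out).k (e b)))) ∧
    ¬ iota p (fun b => ((ThetaData.volumeInputOf D r).σ.localFieldFamily p hp.out).k (e b)) (Fin.last _)
          ((ThetaData.volumeInputOf D r).tΘ p hp.out i (e (Fin.last _)) :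
            ((ThetaData.volumeInputOf D r).σ.localFieldFamily p hp.out).k (e (Fin.last _))) •
        (normalizedPacket p (fun b => ((ThetaData.volumeInputOf D r).σ.localFieldFamily p hp.out).k (e b)) :
          Set (PacketAlgebra p (fun b => ((ThetaData.volumeInputOf D r).σ.localFieldFamily p hp.out).k (e b)))) ⊆
      ((p : ℚ_[p]) ^ (mP p i e + 1)) • (logPacket p (fun b => ((ThetaData.volumeInputOf D r).σ.localFieldFamily p hp.out).k (e b)) :
          Set (PacketAlgebra p (fun b => ((ThetaData.volumeInputOf D r).σ.localFieldFamily p hp.out).k (e b)))))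

include hmP in
/-- **Per prime `p`: the `Pr_K`-weighted LAST-slot content-hull sum over ALL tuples of places of `K` over `p`, for a PER-IMAGE content family of the genuine
input READ BELOW the tuples (`m_K(e) := m_P(p, i, v⃗(e))`), averaged over the procession, IS abc-iut-S7's genuine per-image local term
`negLogThetaPerImageLoc p` of `volumeInputOf D r`** — abc-iut-w5-d056's Galois descent `𝕍(K)_p^{j+1} → V̲ ≅ 𝕍(F_mod)_p^{j+1}`
(`sum_weightPr_mul_contentHull_eq_placeSection`, p439911; `m_K` is `Gal(K/F_mod)`-invariant because conjugate places lie over the same place, `finBelow_smul`;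
at the section `finBelow_lift`) followed by the exact per-image formula `negLogThetaPerImageLoc_eq_of_perImageContent` (abc-iut-s2-p2). The descent step is
abc-iut-s2-p6's `procAvg_sum_weightPr_content_below_eq_negLogThetaLoc` (p447368) VERBATIM — the per-image summand has the SAME shape.
[cite: Mochizuki2012, IUTchIV Thm. 1.10 proof Step (v) p. 28] [cite: Mochizuki2012, IUTchI Rmk. 3.1.5 p. 65] [cite: DupuyHilado2025, Def. 3.6.3, §4.12] -/
theorem procAvg_sum_weightPr_lastSlot_content_below_eq_negLogThetaPerImageLoc (pp : Nat.Primes) :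
    haveI : Fact (pp : ℕ).Prime := ⟨pp.2⟩
    (1 / ((thetaIndex (pilotDataOfK D K)).lstar : ℝ)) * ∑ i : Fin (thetaIndex (pilotDataOfK D K)).lstar,
        ∑ e : (presAt (pilotDataOfK D K) (logvAnalytic_analyticLogv (F := K)) pp).toLocalPieces.E (Setting.labelSucc i),
          weightPr (pilotDataOfK D K) pp.1 (Setting.labelSucc i) e *
            (-(mP pp.1 i (fun b =>
                ⟨Literature.IUT.LogVolume.finBelow (fieldOfModuli E) K (placeOf (pilotDataOfK D K) pp.1 (e b)),
                  finBelow_mem_placesOver (fieldOfModuli E) K (placeOf_mem (pilotDataOfK D K) pp.1 (e b))⟩) * Real.log pp) +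
              packetLogμ pp.1 ((presAt (pilotDataOfK D K) (logvAnalytic_analyticLogv (F := K)) pp).kk e)
                (packetHull pp.1 ((presAt (pilotDataOfK D K) (logvAnalytic_analyticLogv (F := K)) pp).kk e)
                  (logPacket pp.1 ((presAt (pilotDataOfK D K) (logvAnalytic_analyticLogv (F := K)) pp).kk e) :
                    Set ((presAt (pilotDataOfK D K) (logvAnalytic_analyticLogv (F := K)) pp).X e)))) =
      (ThetaData.volumeInputOf D r).negLogThetaPerImageLoc pp.1 := by
  haveI : Fact (pp : ℕ).Prime := ⟨pp.2⟩
  haveI := D.isGalois_fieldOfModuli_K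
  rw [negLogThetaPerImageLoc_eq_of_perImageContent (ThetaData.volumeInputOf D r) pp.1 (mP pp.1) (hmP pp.1)]
  -- both sides are procession averages over `Fin ℓ⋆` (the same type)
  refine congrArg ((1 / ((thetaIndex (pilotDataOfK D K)).lstar : ℝ)) * ·) (Fintype.sum_congr _ _ fun i => ?_)
  -- descend the `K`-level sum to the section (abc-iut-w5-d056), for the label `j = i+1`
  letI : Fintype ((thetaIndex (pilotDataOfK D K)).Caps (Setting.labelSucc i) →
      (thetaIndex (pilotDataOfK D K)).Fibre (.inr (ratPrime pp.1))) :=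
    (presAt (pilotDataOfK D K) (logvAnalytic_analyticLogv (F := K)) pp).toLocalPieces.instFintype (Setting.labelSucc i)
  have hdesc := sum_weightPr_mul_contentHull_eq_placeSection (F₀ := fieldOfModuli E) (pilotDataOfK D K) pp.1
    (Setting.labelSucc i) (ThetaData.placeSection D)
    (fun w => mP pp.1 i (fun a => ⟨Literature.IUT.LogVolume.finBelow (fieldOfModuli E) K (w a).1,
      finBelow_mem_placesOver (fieldOfModuli E) K (w a).2⟩))
    (fun g w => by
      congr 1
      funext a
      exact Subtype.ext (finBelow_smul (fieldOfModuli E) K (g a) (w a).1))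
  refine hdesc.trans (Finset.sum_congr rfl fun v _ => ?_)
  have hv : mP pp.1 i (fun a => ⟨Literature.IUT.LogVolume.finBelow (fieldOfModuli E) K ((ThetaData.placeSection D).lift (v a).1),
      finBelow_mem_placesOver (fieldOfModuli E) K ((ThetaData.placeSection D).lift_mem_placesOver (v a))⟩) = mP pp.1 i v :=
    congrArg (mP pp.1 i) (funext fun a => Subtype.ext (finBelow_lift (fieldOfModuli E) K (ThetaData.placeSection D) (v a).1))
  dsimp only
  rw [hv, mul_comm]
  rfl

variable (M : Type) [Field M] [NumberField M]
  (archPk : ∀ (j : (thetaIndex (pilotDataOfK D K)).Label) (vQ : (thetaIndex (pilotDataOfK D K)).VQ),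
    Set ((logShellsDH (pilotDataOfK D K) (analyticLogv K)).Packet j vQ))
  (archSub : ∀ (j : (thetaIndex (pilotDataOfK D K)).Label) (v : (thetaIndex (pilotDataOfK D K)).V),
    Set ((logShellsDH (pilotDataOfK D K) (analyticLogv K)).Packet j ((thetaIndex (pilotDataOfK D K)).over v)))
  (Ψ : ℤ → ∀ v : (thetaIndex (pilotDataOfK D K)).V, v ∈ (thetaIndex (pilotDataOfK D K)).Vbad →
    Set ((logShellsDH (pilotDataOfK D K) (analyticLogv K)).StarPacket v))
  (act : ℤ → ∀ v : (thetaIndex (pilotDataOfK D K)).V, v ∈ (thetaIndex (pilotDataOfK D K)).Vbad →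
    (logShellsDH (pilotDataOfK D K) (analyticLogv K)).StarPacket v →
      Module.End ℚ ((logShellsDH (pilotDataOfK D K) (analyticLogv K)).StarPacket v))
  (Mmod : ℤ → ∀ j : (thetaIndex (pilotDataOfK D K)).LabelStar,
    Set ((logShellsDH (pilotDataOfK D K) (analyticLogv K)).GlobalPacket j.1))
  (region : ℤ → ∀ j : (thetaIndex (pilotDataOfK D K)).LabelStar, FinDivisor M → ∀ vQ : (thetaIndex (pilotDataOfK D K)).VQ,
    Set ((logShellsDH (pilotDataOfK D K) (analyticLogv K)).Packet j.1 vQ))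
  (n : ℤ) {HT : Type} {LogLink : HT → HT → Type} {IsFull : ∀ {s t : HT}, LogLink s t → Prop}
  (lat : LGPGaussianLogThetaLattice LogLink IsFull)
  {Frd : Type} {IsoF : Frd → Frd → Type} {Ob : Frd → Type} {realify : Frd → Frd} {Strip : Type}
  {IsoS : Strip → Strip → Type}
  {Mv : ∀ v : (thetaIndex (pilotDataOfK D K)).V, v ∈ (thetaIndex (pilotDataOfK D K)).Vbad → Type} [∀ v h, Monoid (Mv v h)]
  (sig : GlobalLGPFrobenioidSignature (thetaIndex (pilotDataOfK D K)).lstar (thetaIndex (pilotDataOfK D K)).V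
    (· ∈ (thetaIndex (pilotDataOfK D K)).Vbad) Frd IsoF Ob realify Strip IsoS Mv)
  (split : SplittingMonoids Mv) {ObΔ : Type}
  {N : ∀ v : (thetaIndex (pilotDataOfK D K)).V, v ∈ (thetaIndex (pilotDataOfK D K)).Vbad → Type} [∀ v h, Monoid (N v h)]
  (qData : QPilotData ObΔ N)
  (tq : ∀ (pp : Nat.Primes) (x : (thetaIndex (pilotDataOfK D K)).Fibre (.inr pp)),
    haveI : Fact (pp : ℕ).Prime := ⟨pp.2⟩; kOf (pilotDataOfK D K) pp.1 x)
  (t : ∀ (pp : Nat.Primes) (_ : Fin (pilotDataOfK D K).lstar) (x : (thetaIndex (pilotDataOfK D K)).Fibre (.inr pp)),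
    haveI : Fact (pp : ℕ).Prime := ⟨pp.2⟩; kOf (pilotDataOfK D K) pp.1 x)
  (htq0 : ∀ pp x, tq pp x ≠ 0)
  (htq1 : ∀ (pp : Nat.Primes) (x : (thetaIndex (pilotDataOfK D K)).Fibre (.inr pp)),
    haveI : Fact (pp : ℕ).Prime := ⟨pp.2⟩; placeOf (pilotDataOfK D K) pp.1 x ∉ (pilotDataOfK D K).S → ‖tq pp x‖ = 1)

include hmP in
/-- **Per packet at EVERY prime, the SLOT term of the `K`-level sharp setting IS the exact LAST-slot content sum**:
`−|log(Θ)|^{(P)}_{i+1,p}(settingPrVolSharp (pilotDataOfK D K) … tq t _ _) = ↑(Σ_e Pr_K(e)·(−m_P(p,i,v⃗(e))·log p + log μ̄_e(hull(log_p R_e^×))))` for EVERY realising Θ-idele `t`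
(`Cor312PilotIdelesPrSlotHull.thetaSlotLocal_settingPrVolSharp_eq_sum_content_hull` at the per-image content family read below the tuples, EXACT at every
`K`-tuple by `content_lastSlot_eq_perImageContentFamily_below`). [cite: Mochizuki2012, IUTchIII Cor. 3.12 proof Step (x) p. 181]
[cite: Mochizuki2012, IUTchIV Thm. 1.10 Step (v) p. 27–28] [cite: DupuyHilado2025, §4.12] -/
theorem thetaSlotLocal_settingPrVolSharp_pilotDataOfK_eq_sum_lastSlot_content_below (ht0 : ∀ pp i x, t pp i x ≠ 0)
    (hT : ∀ (pp : Nat.Primes) (i : Fin (pilotDataOfK D K).lstar) (x : (thetaIndex (pilotDataOfK D K)).Fibre (.inr pp)),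
      haveI : Fact (pp : ℕ).Prime := ⟨pp.2⟩
      Real.log ‖t pp i x‖ = -((pilotDataOfK D K).thetaPilot i (placeOf (pilotDataOfK D K) pp.1 x)) *
        logNorm K (placeOf (pilotDataOfK D K) pp.1 x) / localDegree K (placeOf (pilotDataOfK D K) pp.1 x))
    (pp : Nat.Primes) (i : Fin (thetaIndex (pilotDataOfK D K)).lstar) :
    haveI : Fact (pp : ℕ).Prime := ⟨pp.2⟩
    (settingPrVolSharp (pilotDataOfK D K) (logvAnalytic_analyticLogv (F := K)) M archPk archSub Ψ act Mmod region n lat sig split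
        qData tq t htq0 htq1).thetaSlotLocal (Setting.labelSucc i) (.inr pp) =
      ((∑ e : (presAt (pilotDataOfK D K) (logvAnalytic_analyticLogv (F := K)) pp).toLocalPieces.E (Setting.labelSucc i),
          weightPr (pilotDataOfK D K) pp.1 (Setting.labelSucc i) e *
            (-(mP pp.1 i (fun b =>
                ⟨Literature.IUT.LogVolume.finBelow (fieldOfModuli E) K (placeOf (pilotDataOfK D K) pp.1 (e b)),
                  finBelow_mem_placesOver (fieldOfModuli E) K (placeOf_mem (pilotDataOfK D K) pp.1 (e b))⟩) * Real.log pp) +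
              packetLogμ pp.1 ((presAt (pilotDataOfK D K) (logvAnalytic_analyticLogv (F := K)) pp).kk e)
                (packetHull pp.1 ((presAt (pilotDataOfK D K) (logvAnalytic_analyticLogv (F := K)) pp).kk e)
                  (logPacket pp.1 ((presAt (pilotDataOfK D K) (logvAnalytic_analyticLogv (F := K)) pp).kk e) :
                    Set ((presAt (pilotDataOfK D K) (logvAnalytic_analyticLogv (F := K)) pp).X e)))) : ℝ) : WithTop ℝ) := by
  haveI : Fact (pp : ℕ).Prime := ⟨pp.2⟩
  have ht1 : ∀ (pp : Nat.Primes) (i : Fin (pilotDataOfK D K).lstar) (x : (thetaIndex (pilotDataOfK D K)).Fibre (.inr pp)),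
      haveI : Fact (pp : ℕ).Prime := ⟨pp.2⟩; placeOf (pilotDataOfK D K) pp.1 x ∉ (pilotDataOfK D K).S → ‖t pp i x‖ = 1 :=
    fun pp i x hx => norm_eq_one_of_realising_of_not_mem D t ht0 hT pp i x hx
  exact thetaSlotLocal_settingPrVolSharp_eq_sum_content_hull (pilotDataOfK D K) (logvAnalytic_analyticLogv (F := K)) M archPk archSub Ψ act
    Mmod region n lat sig split qData t tq htq0 htq1 ht0 ht1 i pp
    (fun e => mP pp.1 i (fun b =>
      ⟨Literature.IUT.LogVolume.finBelow (fieldOfModuli E) K (placeOf (pilotDataOfK D K) pp.1 (e b)),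
        finBelow_mem_placesOver (fieldOfModuli E) K (placeOf_mem (pilotDataOfK D K) pp.1 (e b))⟩))
    (fun e => (content_lastSlot_eq_perImageContentFamily_below D t (logvAnalytic_analyticLogv (F := K)) r mP hmP ht0 hT pp i e).1)
    (fun e => (content_lastSlot_eq_perImageContentFamily_below D t (logvAnalytic_analyticLogv (F := K)) r mP hmP ht0 hT pp i e).2)

end Content

/-! ## §2. NONARCHIMEDEAN EXACTNESS of the `K`-level `−|log(Θ)|^{(P)}`, UNCONDITIONAL -/

section Exact

variable (M : Type) [Field M] [NumberField M]
  (archPk : ∀ (j : (thetaIndex (pilotDataOfK D K)).Label) (vQ : (thetaIndex (pilotDataOfK D K)).VQ),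
    Set ((logShellsDH (pilotDataOfK D K) (analyticLogv K)).Packet j vQ))
  (archSub : ∀ (j : (thetaIndex (pilotDataOfK D K)).Label) (v : (thetaIndex (pilotDataOfK D K)).V),
    Set ((logShellsDH (pilotDataOfK D K) (analyticLogv K)).Packet j ((thetaIndex (pilotDataOfK D K)).over v)))
  (Ψ : ℤ → ∀ v : (thetaIndex (pilotDataOfK D K)).V, v ∈ (thetaIndex (pilotDataOfK D K)).Vbad →
    Set ((logShellsDH (pilotDataOfK D K) (analyticLogv K)).StarPacket v))
  (act : ℤ → ∀ v : (thetaIndex (pilotDataOfK D K)).V, v ∈ (thetaIndex (pilotDataOfK D K)).Vbad →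
    (logShellsDH (pilotDataOfK D K) (analyticLogv K)).StarPacket v →
      Module.End ℚ ((logShellsDH (pilotDataOfK D K) (analyticLogv K)).StarPacket v))
  (Mmod : ℤ → ∀ j : (thetaIndex (pilotDataOfK D K)).LabelStar,
    Set ((logShellsDH (pilotDataOfK D K) (analyticLogv K)).GlobalPacket j.1))
  (region : ℤ → ∀ j : (thetaIndex (pilotDataOfK D K)).LabelStar, FinDivisor M → ∀ vQ : (thetaIndex (pilotDataOfK D K)).VQ,
    Set ((logShellsDH (pilotDataOfK D K) (analyticLogv K)).Packet j.1 vQ))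
  (n : ℤ) {HT : Type} {LogLink : HT → HT → Type} {IsFull : ∀ {s t : HT}, LogLink s t → Prop}
  (lat : LGPGaussianLogThetaLattice LogLink IsFull)
  {Frd : Type} {IsoF : Frd → Frd → Type} {Ob : Frd → Type} {realify : Frd → Frd} {Strip : Type}
  {IsoS : Strip → Strip → Type}
  {Mv : ∀ v : (thetaIndex (pilotDataOfK D K)).V, v ∈ (thetaIndex (pilotDataOfK D K)).Vbad → Type} [∀ v h, Monoid (Mv v h)]
  (sig : GlobalLGPFrobenioidSignature (thetaIndex (pilotDataOfK D K)).lstar (thetaIndex (pilotDataOfK D K)).V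
    (· ∈ (thetaIndex (pilotDataOfK D K)).Vbad) Frd IsoF Ob realify Strip IsoS Mv)
  (split : SplittingMonoids Mv) {ObΔ : Type}
  {N : ∀ v : (thetaIndex (pilotDataOfK D K)).V, v ∈ (thetaIndex (pilotDataOfK D K)).Vbad → Type} [∀ v h, Monoid (N v h)]
  (qData : QPilotData ObΔ N)
  (tq : ∀ (pp : Nat.Primes) (x : (thetaIndex (pilotDataOfK D K)).Fibre (.inr pp)),
    haveI : Fact (pp : ℕ).Prime := ⟨pp.2⟩; kOf (pilotDataOfK D K) pp.1 x)
  (t : ∀ (pp : Nat.Primes) (_ : Fin (pilotDataOfK D K).lstar) (x : (thetaIndex (pilotDataOfK D K)).Fibre (.inr pp)),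
    haveI : Fact (pp : ℕ).Prime := ⟨pp.2⟩; kOf (pilotDataOfK D K) pp.1 x)
  (htq0 : ∀ pp x, tq pp x ≠ 0)
  (htq1 : ∀ (pp : Nat.Primes) (x : (thetaIndex (pilotDataOfK D K)).Fibre (.inr pp)),
    haveI : Fact (pp : ℕ).Prime := ⟨pp.2⟩; placeOf (pilotDataOfK D K) pp.1 x ∉ (pilotDataOfK D K).S → ‖tq pp x‖ = 1)

/-- **NONARCHIMEDEAN EXACTNESS IN READING (P), UNCONDITIONAL —
`(settingPrVolSharp (pilotDataOfK D K) … tq t _ _).negLogThetaSlot = ↑(volumeInputOf D r).negLogThetaPerImageNonarch`** for idele data `r` of the initial Θ-data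
`D`, EVERY realising Θ-idele `t` over `K` (`ht0`, `hT`) and ANY `q`-ideles `tq` (non-zero, units off `S`): per packet `=` the exact last-slot content sum at
every prime (§1, at a per-image content family of the genuine input, `exists_perImageContentFamily`), `0` off `T(I)` ([IUTchIV] Thm. 1.10 Step (vi):
`p ∤ 2·disc K` and the Θ-ideles are units there, `thetaSlotLocal_settingPrVolSharp_eq_zero_of_norm_eq_one`) and at `∞` (Step (vii), trivial container,
`thetaSlotLocal_settingPrVolSharp_inl_eq_zero`); `negLogThetaSlot_eq_of_thetaSlotLocal_eq` sums (Step (viii)) and §1's descent reads each prime's term as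
`negLogThetaPerImageLoc p`. The typed per-slot-image `−|log(Θ)|^{(P)}` of abc-iut-C-cert-2's `Cor312SlotHull` over `K` IS abc-iut-S7's genuine
NONARCHIMEDEAN per-image number. [cite: Mochizuki2012, IUTchIII Cor. 3.12 p. 173–174, proof Step (x) p. 181; Thm. 3.11 (i) (Ind2) p. 154]
[cite: Mochizuki2012, IUTchIV Thm. 1.10 Steps (v)–(viii) p. 27–31] [cite: DupuyHilado2025, Def. 3.6.3, §4.9, §4.11–4.12] -/
theorem negLogThetaSlot_settingPrVolSharp_pilotDataOfK_eq_negLogThetaPerImageNonarch (ht0 : ∀ pp i x, t pp i x ≠ 0)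
    (hT : ∀ (pp : Nat.Primes) (i : Fin (pilotDataOfK D K).lstar) (x : (thetaIndex (pilotDataOfK D K)).Fibre (.inr pp)),
      haveI : Fact (pp : ℕ).Prime := ⟨pp.2⟩
      Real.log ‖t pp i x‖ = -((pilotDataOfK D K).thetaPilot i (placeOf (pilotDataOfK D K) pp.1 x)) *
        logNorm K (placeOf (pilotDataOfK D K) pp.1 x) / localDegree K (placeOf (pilotDataOfK D K) pp.1 x)) :
    (settingPrVolSharp (pilotDataOfK D K) (logvAnalytic_analyticLogv (F := K)) M archPk archSub Ψ act Mmod region n lat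
        sig split qData tq t htq0 htq1).negLogThetaSlot =
      (((ThetaData.volumeInputOf D r).negLogThetaPerImageNonarch : ℝ) : WithTop ℝ) := by
  haveI : DecidableEq (thetaIndex (pilotDataOfK D K)).VQ := inferInstanceAs (DecidableEq (Unit ⊕ Nat.Primes))
  -- a per-image content family of the genuine input (contents of the LAST-slot boxes)
  obtain ⟨mP, hmP⟩ := exists_perImageContentFamily (ThetaData.volumeInputOf D r)
  have ht1 : ∀ (pp : Nat.Primes) (i : Fin (pilotDataOfK D K).lstar) (x : (thetaIndex (pilotDataOfK D K)).Fibre (.inr pp)),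
      haveI : Fact (pp : ℕ).Prime := ⟨pp.2⟩; placeOf (pilotDataOfK D K) pp.1 x ∉ (pilotDataOfK D K).S → ‖t pp i x‖ = 1 :=
    fun pp i x hx => norm_eq_one_of_realising_of_not_mem D t ht0 hT pp i x hx
  -- the exact local values: the last-slot content sums on `T(I)`, `0` at `∞`
  let Tp : Finset Nat.Primes := (ThetaData.volumeInputOf D r).supportPrimes.subtype Nat.Prime
  let b : Fin (thetaIndex (pilotDataOfK D K)).lstar → (thetaIndex (pilotDataOfK D K)).VQ → ℝ := fun i vQ =>
    match vQ with
    | .inl _ => 0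
    | .inr pp =>
      haveI : Fact (pp : ℕ).Prime := ⟨pp.2⟩
      ∑ e : (presAt (pilotDataOfK D K) (logvAnalytic_analyticLogv (F := K)) pp).toLocalPieces.E (Setting.labelSucc i),
        weightPr (pilotDataOfK D K) pp.1 (Setting.labelSucc i) e *
          (-(mP pp.1 i (fun b =>
              ⟨Literature.IUT.LogVolume.finBelow (fieldOfModuli E) K (placeOf (pilotDataOfK D K) pp.1 (e b)),
                finBelow_mem_placesOver (fieldOfModuli E) K (placeOf_mem (pilotDataOfK D K) pp.1 (e b))⟩) * Real.log pp) +
            packetLogμ pp.1 ((presAt (pilotDataOfK D K) (logvAnalytic_analyticLogv (F := K)) pp).kk e)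
              (packetHull pp.1 ((presAt (pilotDataOfK D K) (logvAnalytic_analyticLogv (F := K)) pp).kk e)
                (logPacket pp.1 ((presAt (pilotDataOfK D K) (logvAnalytic_analyticLogv (F := K)) pp).kk e) :
                  Set ((presAt (pilotDataOfK D K) (logvAnalytic_analyticLogv (F := K)) pp).X e))))
  -- off `T(I)` and at `∞` the slot term vanishes ([IUTchIV] Thm. 1.10 Steps (vi), (vii) for the setting)
  have hzero : ∀ (i : Fin (thetaIndex (pilotDataOfK D K)).lstar) (vQ : (thetaIndex (pilotDataOfK D K)).VQ),
      vQ ∉ (Tp.image Sum.inr : Finset (thetaIndex (pilotDataOfK D K)).VQ) →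
      (settingPrVolSharp (pilotDataOfK D K) (logvAnalytic_analyticLogv (F := K)) M archPk archSub Ψ act Mmod region n lat sig split
        qData tq t htq0 htq1).thetaSlotLocal (Setting.labelSucc i) vQ = ((0 : ℝ) : WithTop ℝ) := by
    intro i vQ hvQ
    rcases vQ with u | pp
    · exact thetaSlotLocal_settingPrVolSharp_inl_eq_zero (pilotDataOfK D K) (logvAnalytic_analyticLogv (F := K)) M archPk archSub Ψ act Mmod
        region n lat sig split qData t tq htq0 htq1 (Setting.labelSucc i) u
    · haveI : Fact (pp : ℕ).Prime := ⟨pp.2⟩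
      have hpp : (pp : ℕ) ∉ (ThetaData.volumeInputOf D r).supportPrimes := fun h =>
        hvQ (Finset.mem_image_of_mem _ (Finset.mem_subtype.mpr h))
      have hgood : ¬ ((pp : ℕ) ∣ 2 * (NumberField.discr K).natAbs) := fun h =>
        hpp (mem_supportPrimes_of_dvd_or_mem D r pp (Or.inl h))
      have hnotS : ¬ ∃ v ∈ (pilotDataOfK D K).S, ((pp : ℕ) : 𝓞 K) ∈ v.asIdeal := fun h =>
        hpp (mem_supportPrimes_of_dvd_or_mem D r pp (Or.inr h))
      obtain ⟨hp2, hdisc⟩ := good_of_not_dvd (F := K) pp hgood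
      have h1 : ∀ x : (thetaIndex (pilotDataOfK D K)).Fibre (.inr pp), ‖t pp i x‖ = 1 :=
        fun x => ht1 pp i x fun hS => hnotS ⟨_, hS, natCast_mem_placeOf (pilotDataOfK D K) pp.1 x⟩
      exact thetaSlotLocal_settingPrVolSharp_eq_zero_of_norm_eq_one (pilotDataOfK D K) (logvAnalytic_analyticLogv (F := K)) M archPk archSub
        Ψ act Mmod region n lat sig split qData t tq htq0 htq1 ht0 i pp hp2 hdisc h1
  have heq : ∀ (i : Fin (thetaIndex (pilotDataOfK D K)).lstar), ∀ vQ ∈ (Tp.image Sum.inr : Finset (thetaIndex (pilotDataOfK D K)).VQ),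
      (settingPrVolSharp (pilotDataOfK D K) (logvAnalytic_analyticLogv (F := K)) M archPk archSub Ψ act Mmod region n lat sig split
        qData tq t htq0 htq1).thetaSlotLocal (Setting.labelSucc i) vQ = ((b i vQ : ℝ) : WithTop ℝ) := by
    intro i vQ hvQ
    obtain ⟨pp, -, rfl⟩ := Finset.mem_image.mp hvQ
    exact thetaSlotLocal_settingPrVolSharp_pilotDataOfK_eq_sum_lastSlot_content_below D r mP hmP M archPk archSub Ψ act Mmod region n lat
      sig split qData tq t htq0 htq1 ht0 hT pp i
  have hsum : ∑ vQ ∈ (Tp.image Sum.inr : Finset (thetaIndex (pilotDataOfK D K)).VQ),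
      (1 / ((thetaIndex (pilotDataOfK D K)).lstar : ℝ)) * ∑ i : Fin (thetaIndex (pilotDataOfK D K)).lstar, b i vQ =
      ∑ pp ∈ Tp, (1 / ((thetaIndex (pilotDataOfK D K)).lstar : ℝ)) * ∑ i : Fin (thetaIndex (pilotDataOfK D K)).lstar, b i (.inr pp) :=
    Finset.sum_image fun x _ y _ h => Sum.inr_injective h
  rw [(settingPrVolSharp (pilotDataOfK D K) (logvAnalytic_analyticLogv (F := K)) M archPk archSub Ψ act Mmod region n lat sig split
      qData tq t htq0 htq1).negLogThetaSlot_eq_of_thetaSlotLocal_eq (Tp.image Sum.inr) b hzero heq, hsum,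
    ThetaVolumeInput.negLogThetaPerImageNonarch,
    ← Finset.sum_subtype_of_mem (fun p => (ThetaData.volumeInputOf D r).negLogThetaPerImageLoc p)
      (fun p hp => (ThetaData.volumeInputOf D r).prime_of_mem_supportPrimes hp)]
  congr 1
  refine Finset.sum_congr rfl fun pp _ => ?_
  exact procAvg_sum_weightPr_lastSlot_content_below_eq_negLogThetaPerImageLoc D r mP hmP pp

/-- **… for ANY genuine Θ-volume input `I` of `D`** (abc-iut-S2 `exists_eq_volumeInputOf`):
`(settingPrVolSharp (pilotDataOfK D K) … tq t _ _).negLogThetaSlot = ↑I.negLogThetaPerImageNonarch`.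
[cite: Mochizuki2012, IUTchIII Cor. 3.12 proof Step (x) p. 181] [cite: Mochizuki2012, IUTchIV Thm. 1.10 Steps (v)–(viii) p. 27–31] -/
theorem negLogThetaSlot_settingPrVolSharp_pilotDataOfK_eq_negLogThetaPerImageNonarch_of_isVolumeInputOf (ht0 : ∀ pp i x, t pp i x ≠ 0)
    (hT : ∀ (pp : Nat.Primes) (i : Fin (pilotDataOfK D K).lstar) (x : (thetaIndex (pilotDataOfK D K)).Fibre (.inr pp)),
      haveI : Fact (pp : ℕ).Prime := ⟨pp.2⟩
      Real.log ‖t pp i x‖ = -((pilotDataOfK D K).thetaPilot i (placeOf (pilotDataOfK D K) pp.1 x)) *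
        logNorm K (placeOf (pilotDataOfK D K) pp.1 x) / localDegree K (placeOf (pilotDataOfK D K) pp.1 x))
    {I : ThetaVolumeInput (fieldOfModuli E) K} (hI : ThetaData.IsVolumeInputOf D I) :
    (settingPrVolSharp (pilotDataOfK D K) (logvAnalytic_analyticLogv (F := K)) M archPk archSub Ψ act Mmod region n lat
        sig split qData tq t htq0 htq1).negLogThetaSlot = ((I.negLogThetaPerImageNonarch : ℝ) : WithTop ℝ) := by
  obtain ⟨r, rfl⟩ := ThetaData.exists_eq_volumeInputOf D hI
  exact negLogThetaSlot_settingPrVolSharp_pilotDataOfK_eq_negLogThetaPerImageNonarch D r M archPk archSub Ψ act Mmod region n lat sig split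
    qData tq t htq0 htq1 ht0 hT

/-- **THE READ-P BOUND: `(settingPrVolSharp (pilotDataOfK D K) … tq t _ _).negLogThetaSlot ≤ ↑I.negLogThetaPerImage`** for ANY genuine Θ-volume input `I` of
`D`, EVERY realising Θ-idele and ANY `q`-ideles — the nonarchimedean EQUALITY plus abc-iut-S7's `negLogThetaPerImage = negLogThetaPerImageNonarch +
((l+5)/4)·log π` with `((l+5)/4)·log π > 0` (abc-iut-S2 `archLogTheta_pos`; the setting's archimedean term is `0`, trivial container — the slack of the
READ-P binder is EXACTLY the archimedean summand of [IUTchIV] Thm. 1.10 Step (vii)). [cite: Mochizuki2012, IUTchIV Thm. 1.10 Step (vii) p. 30]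
[cite: Mochizuki2012, IUTchIII Cor. 3.12 proof Step (x) p. 181] -/
theorem negLogThetaSlot_settingPrVolSharp_pilotDataOfK_le_negLogThetaPerImage_of_isVolumeInputOf (ht0 : ∀ pp i x, t pp i x ≠ 0)
    (hT : ∀ (pp : Nat.Primes) (i : Fin (pilotDataOfK D K).lstar) (x : (thetaIndex (pilotDataOfK D K)).Fibre (.inr pp)),
      haveI : Fact (pp : ℕ).Prime := ⟨pp.2⟩
      Real.log ‖t pp i x‖ = -((pilotDataOfK D K).thetaPilot i (placeOf (pilotDataOfK D K) pp.1 x)) *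
        logNorm K (placeOf (pilotDataOfK D K) pp.1 x) / localDegree K (placeOf (pilotDataOfK D K) pp.1 x))
    {I : ThetaVolumeInput (fieldOfModuli E) K} (hI : ThetaData.IsVolumeInputOf D I) :
    (settingPrVolSharp (pilotDataOfK D K) (logvAnalytic_analyticLogv (F := K)) M archPk archSub Ψ act Mmod region n lat
        sig split qData tq t htq0 htq1).negLogThetaSlot ≤ ((I.negLogThetaPerImage : ℝ) : WithTop ℝ) := by
  rw [negLogThetaSlot_settingPrVolSharp_pilotDataOfK_eq_negLogThetaPerImageNonarch_of_isVolumeInputOf D M archPk archSub Ψ act Mmod region n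
    lat sig split qData tq t htq0 htq1 ht0 hT hI, WithTop.coe_le_coe]
  show I.negLogThetaPerImageNonarch ≤ I.negLogThetaPerImageNonarch + ThetaVolumeInput.archLogTheta I.l
  exact le_add_of_nonneg_right (ThetaVolumeInput.archLogTheta_pos I.l).le

end Exact

end Summit.ABC.IUTFork.Thm311.Real

end
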